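import Summits.FinalStateConjecture.FinalStateConjecture.Theorems.EIHFluxBalanceInertialRecessionHonestMap
import Summits.FinalStateConjecture.FinalStateConjecture.Theorems.EIHFluxBalanceInertialRecessionSMatrix
import Summits.FinalStateConjecture.FinalStateConjecture.Theorems.EIHFluxBalanceInertialRecessionPullback
import Summits.FinalStateConjecture.FinalStateConjecture.Theorems.EIHFluxBalanceInertialRecessionFlatChart
import Summits.FinalStateConjecture.FinalStateConjecture.Theorems.EIHFluxBalanceInertialRecessionBoostCalculus

/-!
# Route EIHFluxBalance — `InertialRecession`: the transported ansatz versus the boosted Kerr model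

Helper file for the crux `stmt-FinalStateConjecture-10166`
(`Summit.FinalStateConjecture.FinalStateConjecture.Theses.EIHFluxBalance.InertialRecession`).

Pointwise heart of the near-zone convergence of the `a = 0` hole charts `Φ ∘ A`: by the
re-charting identity (`…Pullback`), `(Φ ∘ A)^* g − g_{K∞} = (Φ^*g − g_B)(A ·)[DA, DA] + G` with the
**transport defect** `G(y) = g_B(A y)[DA(y) ·, DA(y) ·] − g_{K∞}(y)`, where `g_B = η + Σⱼ hⱼ` is the
painted multi-hole field (frames normalised to pure boosts, `a = 0`) and `g_{K∞}` the boosted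
Schwarzschild model of the final motion `(boost V, 0)`. This file proves
`G = T + Σ_{j ≠ i} hⱼ(A ·)[DA, DA]` with the model defect `T` of `…SMatrix` — the painted field of
hole `i` at `A(y)` IS the rest-frame Kerr–Schild form at `Λ∞⁻¹ y` in the frame
`boost(−vᵢ(t)) ∘ DA(y)` (`boostedKerrBilin_boost_honest`, exact, from the horizon-normalisation
algebra) — records the smoothness and kinematic bounds of the honest placement
(`spatialNorm_own_honest'`, `contDiff_honest`, `honest_kinematic_bounds`) and the smoothness of
the transport defect (`contDiffAt_transportDefect`); the `C²` estimate is in the sibling file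
`…HoleTransportEstimate`.
-/

noncomputable section

open scoped Topology ContDiff InnerProductSpace BigOperators Manifold
open Filter Set Metric Function TopologicalSpace Literature.Geometry.Lorentzian

namespace Summit.FinalStateConjecture.FinalStateConjecture.Theorems

/-! ### Algebra of the transported one-hole field -/

/-- Composition of frames: `(Q[a ·, a ·])[D ·, D ·] = Q[(a ∘ D) ·, (a ∘ D) ·]`. [folklore] -/
theorem bilinearComp_bilinearComp (Q : E4 →L[ℝ] E4 →L[ℝ] ℝ) (a D : E4 →L[ℝ] E4) :
    (Q.bilinearComp a a).bilinearComp D D = Q.bilinearComp (a.comp D) (a.comp D) := by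
  ext p q
  rfl

/-- **The painted field of a pure-boost hole at an honestly placed point.** For `‖u‖ < 1`, centre
`(θ, ζ)` and rest offset `z`: `boostedKerrBilin (boost u) (θ, ζ) M 0 (θ, ζ + L_u z) =
g_{M,0}(y₀)[boost(−u) ·, boost(−u) ·]` for any `y₀` with `y₀~ = z` (the rest-frame point
`boost(−u)(0, L_u z)` has spatial part `P_u L_u z = z`). [folklore] -/
theorem boostedKerrBilin_boost_honest {u : E3} (hu : ‖u‖ < 1) (θ : ℝ) (ζ z : E3) (M : ℝ) {y₀ : E4}
    (hy₀ : E4.spatial y₀ = z) :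
    boostedKerrBilin (Lorentz.boost u hu) (E4.ofTimeSpace θ ζ) M 0
        (E4.ofTimeSpace θ (ζ + (z - (Lorentz.gamma u / (Lorentz.gamma u + 1) * inner ℝ u z) • u))) =
      (Kerr.bilin M 0 y₀).bilinearComp (Lorentz.boostCLM (-u)) (Lorentz.boostCLM (-u)) := by
  set z' : E3 := z - (Lorentz.gamma u / (Lorentz.gamma u + 1) * inner ℝ u z) • u with hz'
  have hsymm : ∀ p : E4, (Lorentz.boost u hu : E4 ≃L[ℝ] E4).symm p = Lorentz.boostCLM (-u) p :=
    fun p ↦ DFunLike.congr_fun (coe_boost_symm' hu) p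
  have hdiff : E4.ofTimeSpace θ (ζ + z') - E4.ofTimeSpace θ ζ = E4.ofTimeSpace 0 z' := by
    rw [E4.ofTimeSpace_eq_smul_add', E4.ofTimeSpace_eq_smul_add', E4.ofTimeSpace_eq_smul_add',
      map_add, zero_smul, zero_add]
    abel
  have hP : poincareInv (Lorentz.boost u hu) (E4.ofTimeSpace θ ζ) (E4.ofTimeSpace θ (ζ + z')) =
      Lorentz.boostCLM (-u) (E4.ofTimeSpace 0 z') := by
    rw [poincareInv, hdiff, hsymm]
  have hsp : E4.spatial (Lorentz.boostCLM (-u) (E4.ofTimeSpace 0 z')) = E4.spatial y₀ := by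
    rw [spatial_boostCLM_neg_ofTimeSpace_zero, hz', restOffset_leftInverse hu, hy₀]
  refine ContinuousLinearMap.ext fun p ↦ ContinuousLinearMap.ext fun q ↦ ?_
  rw [boostedKerrBilin_apply, ContinuousLinearMap.bilinearComp_apply, hP,
    kerr_bilin_eq_of_spatial_eq M 0 hsp, hsymm, hsymm]

/-- **The boosted Schwarzschild model in the same form**:
`boostedKerrBilin Λ 0 M 0 y = g_{M,0}(Λ⁻¹ y)[Λ⁻¹ ·, Λ⁻¹ ·]`. [folklore] -/
theorem boostedKerrBilin_zero_eq_bilinearComp (Λ : lorentzGroup) (M : ℝ) (y : E4) :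
    boostedKerrBilin Λ 0 M 0 y =
      (Kerr.bilin M 0 ((Λ : E4 ≃L[ℝ] E4).symm y)).bilinearComp
        ((Λ : E4 ≃L[ℝ] E4).symm : E4 →L[ℝ] E4) ((Λ : E4 ≃L[ℝ] E4).symm : E4 →L[ℝ] E4) := by
  refine ContinuousLinearMap.ext fun p ↦ ContinuousLinearMap.ext fun q ↦ ?_
  rw [boostedKerrBilin_apply, ContinuousLinearMap.bilinearComp_apply, poincareInv_zero]
  rfl

/-- `bilinearComp` is additive in the form. [folklore] -/
theorem add_bilinearComp (A B : E4 →L[ℝ] E4 →L[ℝ] ℝ) (D D' : E4 →L[ℝ] E4) :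
    (A + B).bilinearComp D D' = A.bilinearComp D D' + B.bilinearComp D D' := by
  ext p q
  rfl

/-- `bilinearComp` commutes with finite sums of forms. [folklore] -/
theorem sum_bilinearComp {ι : Type*} (s : Finset ι) (g : ι → E4 →L[ℝ] E4 →L[ℝ] ℝ)
    (D D' : E4 →L[ℝ] E4) :
    (∑ j ∈ s, g j).bilinearComp D D' = ∑ j ∈ s, (g j).bilinearComp D D' := by
  classical
  induction s using Finset.induction_on with
  | empty =>
    simp only [Finset.sum_empty]
    ext p q
    rfl
  | insert j s hj ih =>
    rw [Finset.sum_insert hj, Finset.sum_insert hj, add_bilinearComp, ih]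

/-! ### The transport defect -/

section Transport

variable {N : ℕ} (i : Fin N) (M : Fin N → ℝ) (ξ v : Fin N → ℝ → E3) (hv1 : ∀ j t, ‖v j t‖ < 1)
  {V : E3} (hV : ‖V‖ < 1) {Ah : E4 → E4}
  (hAh : ∀ y : E4, Ah y = E4.ofTimeSpace (y 0) (ξ i (y 0) +
    (ContinuousLinearMap.id ℝ E3 - (Lorentz.gamma (v i (y 0)) / (Lorentz.gamma (v i (y 0)) + 1)) •
      (innerSL ℝ (v i (y 0))).smulRight (v i (y 0)))
      (E4.spatial ((Lorentz.boost V hV : E4 ≃L[ℝ] E4).symm y))))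
  {H : Fin N → E4 → E4 →L[ℝ] E4 →L[ℝ] ℝ}
  (hH : ∀ j z, H j z = boostedKerrBilin (Lorentz.boost (v j (z 0)) (hv1 j (z 0)))
    (E4.ofTimeSpace (z 0) (ξ j (z 0))) (M j) 0 z - Minkowski.bilin)
  {Bb : E4 → E4 →L[ℝ] E4 →L[ℝ] ℝ} (hBb : ∀ z, Bb z = Minkowski.bilin + ∑ j, H j z)

include hAh hH hBb in
/-- **Decomposition of the transport defect**: with `Hⱼ` the painted pure-boost summands and
`g_B = η + Σⱼ Hⱼ`, `g_B(A y)[D, D] − g_{K∞}(y) = T(y) + Σ_{j ≠ i} Hⱼ(A y)[D, D]`, where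
`T(y) = K(y)[S, S] − K(y)[Λ∞⁻¹, Λ∞⁻¹]`, `K(y) = g_{Mᵢ,0}(Λ∞⁻¹ y)`, `S = boost(−vᵢ(y⁰)) ∘ D`.
[folklore] -/
theorem transportDefect_eq (y : E4) (D : E4 →L[ℝ] E4) :
    (Bb (Ah y)).bilinearComp D D - boostedKerrBilin (Lorentz.boost V hV) 0 (M i) 0 y =
    ((Kerr.bilin (M i) 0 ((Lorentz.boost V hV : E4 ≃L[ℝ] E4).symm y)).bilinearComp
        ((Lorentz.boostCLM (-v i (y 0))).comp D) ((Lorentz.boostCLM (-v i (y 0))).comp D) -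
      (Kerr.bilin (M i) 0 ((Lorentz.boost V hV : E4 ≃L[ℝ] E4).symm y)).bilinearComp
        ((Lorentz.boost V hV : E4 ≃L[ℝ] E4).symm : E4 →L[ℝ] E4)
        ((Lorentz.boost V hV : E4 ≃L[ℝ] E4).symm : E4 →L[ℝ] E4)) +
    ∑ j ∈ Finset.univ.erase i, (H j (Ah y)).bilinearComp D D := by
  have hA0 : Ah y 0 = y 0 := by rw [hAh y, E4.ofTimeSpace_apply_zero]
  -- the own summand is the rest-frame form in the transported frame
  have hown : H i (Ah y) + Minkowski.bilin =
      (Kerr.bilin (M i) 0 ((Lorentz.boost V hV : E4 ≃L[ℝ] E4).symm y)).bilinearComp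
        (Lorentz.boostCLM (-v i (y 0))) (Lorentz.boostCLM (-v i (y 0))) := by
    rw [hH]
    have e : ∀ A B : E4 →L[ℝ] E4 →L[ℝ] ℝ, A - B + B = A := fun A B ↦ by abel
    rw [e]
    have h := boostedKerrBilin_boost_honest (hv1 i (y 0)) (y 0) (ξ i (y 0))
      (E4.spatial ((Lorentz.boost V hV : E4 ≃L[ℝ] E4).symm y)) (M i)
      (y₀ := (Lorentz.boost V hV : E4 ≃L[ℝ] E4).symm y) rfl
    have hAy : Ah y = E4.ofTimeSpace (y 0) (ξ i (y 0) +
        (E4.spatial ((Lorentz.boost V hV : E4 ≃L[ℝ] E4).symm y) -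
          (Lorentz.gamma (v i (y 0)) / (Lorentz.gamma (v i (y 0)) + 1) *
            inner ℝ (v i (y 0)) (E4.spatial ((Lorentz.boost V hV : E4 ≃L[ℝ] E4).symm y))) •
            v i (y 0))) := by
      rw [hAh y, restOffsetCLM_apply]
    have hboost : ∀ {s s' : ℝ} (hs : s = s'),
        Lorentz.boost (v i s) (hv1 i s) = Lorentz.boost (v i s') (hv1 i s') := by
      intro s s' hs; subst hs; rfl
    rw [hboost hA0, hA0, hAy]
    exact h
  have hmodel := boostedKerrBilin_zero_eq_bilinearComp (Lorentz.boost V hV) (M i) y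
  -- split the sum at `i`
  set S := ∑ j ∈ Finset.univ.erase i, H j (Ah y) with hS
  rw [hBb, ← Finset.add_sum_erase Finset.univ _ (Finset.mem_univ i), ← hS]
  have e1 : Minkowski.bilin + (H i (Ah y) + S) = (H i (Ah y) + Minkowski.bilin) + S := by abel
  rw [e1, add_bilinearComp, hown, hmodel, hS, sum_bilinearComp, bilinearComp_bilinearComp]
  abel

end Transport

/-! ### The `C²` estimate of the transport defect -/

section Estimate

variable {N : ℕ} (i : Fin N) (M : Fin N → ℝ) (ξ v : Fin N → ℝ → E3) (hv1 : ∀ j t, ‖v j t‖ < 1)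
  {V : E3} (hV : ‖V‖ < 1) {Ah : E4 → E4}
  (hAh : ∀ y : E4, Ah y = E4.ofTimeSpace (y 0) (ξ i (y 0) +
    (ContinuousLinearMap.id ℝ E3 - (Lorentz.gamma (v i (y 0)) / (Lorentz.gamma (v i (y 0)) + 1)) •
      (innerSL ℝ (v i (y 0))).smulRight (v i (y 0)))
      (E4.spatial ((Lorentz.boost V hV : E4 ≃L[ℝ] E4).symm y))))
  {H : Fin N → E4 → E4 →L[ℝ] E4 →L[ℝ] ℝ}
  (hH : ∀ j z, H j z = boostedKerrBilin (Lorentz.boost (v j (z 0)) (hv1 j (z 0)))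
    (E4.ofTimeSpace (z 0) (ξ j (z 0))) (M j) 0 z - Minkowski.bilin)
  {Bb : E4 → E4 →L[ℝ] E4 →L[ℝ] ℝ} (hBb : ∀ z, Bb z = Minkowski.bilin + ∑ j, H j z)
  (hξ : ∀ j, ContDiff ℝ ∞ (ξ j)) (hv : ∀ j, ContDiff ℝ ∞ (v j))

include hv1 hAh in
/-- **Exact horizon normalisation of the honest placement**: the painted (spin `0`) radius of `A x`
relative to hole `i`'s own pure-boost frame is `‖(Λ∞⁻¹x)~‖`. [folklore] -/
theorem spatialNorm_own_honest' (x : E4) :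
    E4.spatialNorm (Lorentz.boostCLM (-v i (Ah x 0)) (Ah x - E4.ofTimeSpace (Ah x 0) (ξ i (Ah x 0)))) =
      ‖E4.spatial ((Lorentz.boost V hV : E4 ≃L[ℝ] E4).symm x)‖ := by
  have hA0 : Ah x 0 = x 0 := by rw [hAh x, E4.ofTimeSpace_apply_zero]
  have h0 : 0 < ((Lorentz.boost (v i (Ah x 0)) (hv1 i (Ah x 0)) : E4 ≃L[ℝ] E4)
      (E4.basisVector 0)) 0 := by
    rw [Lorentz.boost_apply_basisVector_zero_zero]
    exact Lorentz.gamma_pos (hv1 i (Ah x 0))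
  have hvΛ := Lorentz.spatial_boost_apply_basisVector_zero (hv1 i (Ah x 0))
  have key := spatialNorm_symm_ofTimeSpace_restOffset' (Lorentz.boost (v i (Ah x 0))
    (hv1 i (Ah x 0))) h0 hvΛ (E4.spatial ((Lorentz.boost V hV : E4 ≃L[ℝ] E4).symm x))
  have hdiff : Ah x - E4.ofTimeSpace (Ah x 0) (ξ i (Ah x 0)) = E4.ofTimeSpace 0
      (E4.spatial ((Lorentz.boost V hV : E4 ≃L[ℝ] E4).symm x) -
        (Lorentz.gamma (v i (Ah x 0)) / (Lorentz.gamma (v i (Ah x 0)) + 1) *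
          inner ℝ (v i (Ah x 0)) (E4.spatial ((Lorentz.boost V hV : E4 ≃L[ℝ] E4).symm x))) •
          v i (Ah x 0)) := by
    rw [hA0]
    conv_lhs => rw [hAh x]
    rw [restOffsetCLM_apply, E4.ofTimeSpace_eq_smul_add', E4.ofTimeSpace_eq_smul_add',
      E4.ofTimeSpace_eq_smul_add', map_add, zero_smul, zero_add]
    abel
  rw [hdiff, ← coe_boost_symm' (hv1 i (Ah x 0)), ContinuousLinearEquiv.coe_coe, key]

include hAh hξ hv hv1 in
/-- The honest placement of hole `i` is smooth. [folklore] -/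
theorem contDiff_honest : ContDiff ℝ ∞ Ah := by
  set Lv : ℝ → E3 →L[ℝ] E3 := fun s ↦ ContinuousLinearMap.id ℝ E3 -
    (Lorentz.gamma (v i s) / (Lorentz.gamma (v i s) + 1)) • (innerSL ℝ (v i s)).smulRight (v i s)
    with hLv
  have hLvc : ContDiff ℝ ∞ Lv := by
    have hmaps : ∀ t, v i t ∈ ball (0 : E3) 1 := fun t ↦ by simpa using hv1 i t
    refine contDiff_iff_contDiffAt.mpr fun t ↦ ?_
    exact ((contDiffOn_restOffsetCLM (v i t) (hmaps t)).contDiffAt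
      (isOpen_ball.mem_nhds (hmaps t))).comp t (hv i).contDiffAt
  have hAh' : ∀ y : E4, Ah y = E4.ofTimeSpace (y 0) (ξ i (y 0) +
      Lv (y 0) (E4.spatial ((Lorentz.boost V hV : E4 ≃L[ℝ] E4).symm y))) := fun y ↦ by
    rw [hAh y]
  exact contDiff_honestMap hV hAh' (hξ i) hLvc

include hAh hξ hv hv1 in
/-- **Kinematic bounds on the honest placement.** If at lab time `t = x⁰` the painted centre and
rest-offset map of hole `i` are `δ₀`-close to the frozen data (second and third derivative of
`ξᵢ`, first three derivatives of `L`, `L − L_V`, all `≤ δ₀`, and `‖ξᵢ' − V‖ ≤ δ₀`) and `‖y̲‖ ≤ R`,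
then `‖DA − 1‖ ≤ δ` and `‖DʲA‖ ≤ δ` (`j = 2, 3`) with `δ = (4 + R + 3‖Λ∞⁻¹‖) δ₀`; if moreover
`δ ≤ 1` then `‖DʲA‖ ≤ 2` for `1 ≤ j ≤ 3`. [folklore] -/
theorem honest_kinematic_bounds {x : E4} {R δ₀ : ℝ}
    (hR : ‖E4.spatial ((Lorentz.boost V hV : E4 ≃L[ℝ] E4).symm x)‖ ≤ R) (hδ0 : 0 ≤ δ₀)
    (hk1 : ‖deriv (ξ i) (x 0) - V‖ ≤ δ₀)
    (hk2 : ∀ l, 2 ≤ l → l ≤ 3 → ‖iteratedDeriv l (ξ i) (x 0)‖ ≤ δ₀)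
    (hk3 : ∀ l, 1 ≤ l → l ≤ 3 → ‖iteratedDeriv l (fun s ↦ ContinuousLinearMap.id ℝ E3 -
      (Lorentz.gamma (v i s) / (Lorentz.gamma (v i s) + 1)) • (innerSL ℝ (v i s)).smulRight (v i s))
        (x 0)‖ ≤ δ₀)
    (hk4 : ‖(ContinuousLinearMap.id ℝ E3 - (Lorentz.gamma (v i (x 0)) / (Lorentz.gamma (v i (x 0)) + 1)) •
        (innerSL ℝ (v i (x 0))).smulRight (v i (x 0))) - (ContinuousLinearMap.id ℝ E3 -
          (Lorentz.gamma V / (Lorentz.gamma V + 1)) • (innerSL ℝ V).smulRight V)‖ ≤ δ₀) :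
    ‖fderiv ℝ Ah x - ContinuousLinearMap.id ℝ E4‖ ≤
        (4 + R + 3 * ‖(((Lorentz.boost V hV : E4 ≃L[ℝ] E4).symm : E4 →L[ℝ] E4))‖) * δ₀ ∧
      (∀ j, 2 ≤ j → j ≤ 3 → ‖iteratedFDeriv ℝ j Ah x‖ ≤
        (4 + R + 3 * ‖(((Lorentz.boost V hV : E4 ≃L[ℝ] E4).symm : E4 →L[ℝ] E4))‖) * δ₀) ∧
      ((4 + R + 3 * ‖(((Lorentz.boost V hV : E4 ≃L[ℝ] E4).symm : E4 →L[ℝ] E4))‖) * δ₀ ≤ 1 →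
        ∀ j, 1 ≤ j → j ≤ 3 → ‖iteratedFDeriv ℝ j Ah x‖ ≤ 2) := by
  set Λi : E4 →L[ℝ] E4 := (((Lorentz.boost V hV : E4 ≃L[ℝ] E4).symm : E4 →L[ℝ] E4)) with hΛi
  set δ : ℝ := (4 + R + 3 * ‖Λi‖) * δ₀ with hδ
  set Lv : ℝ → E3 →L[ℝ] E3 := fun s ↦ ContinuousLinearMap.id ℝ E3 -
    (Lorentz.gamma (v i s) / (Lorentz.gamma (v i s) + 1)) • (innerSL ℝ (v i s)).smulRight (v i s)
    with hLv
  have hLvc : ContDiff ℝ ∞ Lv := by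
    have hmaps : ∀ t, v i t ∈ ball (0 : E3) 1 := fun t ↦ by simpa using hv1 i t
    refine contDiff_iff_contDiffAt.mpr fun t ↦ ?_
    exact ((contDiffOn_restOffsetCLM (v i t) (hmaps t)).contDiffAt
      (isOpen_ball.mem_nhds (hmaps t))).comp t (hv i).contDiffAt
  have hAh' : ∀ y : E4, Ah y = E4.ofTimeSpace (y 0) (ξ i (y 0) +
      Lv (y 0) (E4.spatial ((Lorentz.boost V hV : E4 ≃L[ℝ] E4).symm y))) := fun y ↦ by
    rw [hAh y]
  have hR0 : 0 ≤ R := (norm_nonneg _).trans hR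
  have hDA : ‖fderiv ℝ Ah x - ContinuousLinearMap.id ℝ E4‖ ≤ δ := by
    refine (norm_fderiv_honestMap_sub_id_le' hV hAh' (hξ i) hLvc x).trans ?_
    have h1 := hk3 1 le_rfl (by norm_num)
    rw [iteratedDeriv_one] at h1
    have h2 : ‖deriv Lv (x 0)‖ * ‖E4.spatial ((Lorentz.boost V hV : E4 ≃L[ℝ] E4).symm x)‖ ≤ δ₀ * R :=
      mul_le_mul h1 hR (norm_nonneg _) hδ0
    have h3 : ‖Lv (x 0) - (ContinuousLinearMap.id ℝ E3 - (Lorentz.gamma V / (Lorentz.gamma V + 1)) •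
        (innerSL ℝ V).smulRight V)‖ * ‖Λi‖ ≤ δ₀ * ‖Λi‖ :=
      mul_le_mul_of_nonneg_right hk4 (norm_nonneg _)
    rw [hδ]
    nlinarith [norm_nonneg Λi]
  have hDk : ∀ j, 2 ≤ j → j ≤ 3 → ‖iteratedFDeriv ℝ j Ah x‖ ≤ δ := by
    intro j hj2 hj3
    refine (norm_iteratedFDeriv_honestMap_le' hV hAh' (hξ i) hLvc x hj2).trans ?_
    have h1 := hk2 j hj2 hj3
    have h2 : ‖iteratedDeriv j Lv (x 0)‖ * ‖E4.spatial ((Lorentz.boost V hV : E4 ≃L[ℝ] E4).symm x)‖ ≤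
        δ₀ * R := mul_le_mul (hk3 j (by omega) hj3) hR (norm_nonneg _) hδ0
    have h3 : (j : ℝ) * ‖iteratedDeriv (j - 1) Lv (x 0)‖ * ‖Λi‖ ≤ 3 * δ₀ * ‖Λi‖ := by
      have hj' : (j : ℝ) ≤ 3 := by exact_mod_cast hj3
      have := hk3 (j - 1) (by omega) (by omega)
      exact mul_le_mul (mul_le_mul hj' this (norm_nonneg _) (by norm_num)) le_rfl (norm_nonneg _)
        (by positivity)
    rw [hδ]
    nlinarith [norm_nonneg Λi]
  refine ⟨hDA, hDk, fun hδ1 j hj1 hj3 ↦ ?_⟩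
  rcases eq_or_lt_of_le hj1 with h | h
  · rw [← h, ← norm_iteratedFDeriv_fderiv, norm_iteratedFDeriv_zero]
    have := norm_add_le (fderiv ℝ Ah x - ContinuousLinearMap.id ℝ E4) (ContinuousLinearMap.id ℝ E4)
    rw [sub_add_cancel] at this
    linarith [ContinuousLinearMap.norm_id_le (𝕜 := ℝ) (E := E4)]
  · linarith [hDk j (by omega) hj3]

include hAh hH hBb hξ hv hv1 in
/-- **The transport defect is smooth** at every model point `x` with `‖(Λ∞⁻¹x)~‖ > 0` at which
every other painted summand has positive painted radius at `A x` (the own summand has painted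
radius `‖(Λ∞⁻¹x)~‖` there by the exact horizon normalisation). [folklore] -/
theorem contDiffAt_transportDefect {x : E4}
    (hr : 0 < ‖E4.spatial ((Lorentz.boost V hV : E4 ≃L[ℝ] E4).symm x)‖)
    (hoth : ∀ j ≠ i, 0 < E4.spatialNorm (Lorentz.boostCLM (-v j (Ah x 0))
        (Ah x - E4.ofTimeSpace (Ah x 0) (ξ j (Ah x 0))))) :
    ContDiffAt ℝ ∞ (fun y ↦ (Bb (Ah y)).bilinearComp (fderiv ℝ Ah y) (fderiv ℝ Ah y) -
        boostedKerrBilin (Lorentz.boost V hV) 0 (M i) 0 y) x := by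
  have hAc : ContDiff ℝ ∞ Ah := contDiff_honest i ξ v hv1 hV hAh hξ hv
  have hA0 : Ah x 0 = x 0 := by rw [hAh x, E4.ofTimeSpace_apply_zero]
  -- every summand is smooth at `Ah x`
  have hHc : ∀ j, ContDiffAt ℝ ∞ (H j) (Ah x) := by
    intro j
    have hΛjc : ContDiff ℝ ∞ (fun s ↦ (((Lorentz.boost (v j s) (hv1 j s) : E4 ≃L[ℝ] E4).symm :
        E4 →L[ℝ] E4))) :=
      contDiff_iff_contDiffAt.mpr fun s ↦
        (contDiff_boostCLM_neg_comp (hv j) (hv1 j)).contDiffAt.congr_of_eventuallyEq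
          (Filter.Eventually.of_forall fun s ↦ coe_boost_symm' (hv1 j s))
    have hrad : 0 < Kerr.radius 0 ((((Lorentz.boost (v j (Ah x 0)) (hv1 j (Ah x 0)) :
        E4 ≃L[ℝ] E4).symm : E4 →L[ℝ] E4)) (Ah x - E4.ofTimeSpace (Ah x 0) (ξ j (Ah x 0)))) := by
      rw [Kerr.radius_zero_left]
      by_cases hj : j = i
      · subst hj
        -- own summand: exact horizon normalisation
        rw [coe_boost_symm' (hv1 j (Ah x 0)), spatialNorm_own_honest' j ξ v hv1 hV hAh x]
        exact hr
      · rw [coe_boost_symm' (hv1 j (Ah x 0))]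
        exact hoth j hj
    exact (contDiffAt_ansatzSummand (M := M j) (a := 0) hΛjc (hξ j) hrad).congr_of_eventuallyEq
      (Filter.Eventually.of_forall (hH j))
  have hBbc : ContDiffAt ℝ ∞ Bb (Ah x) := by
    have : ContDiffAt ℝ ∞ (fun z ↦ Minkowski.bilin + ∑ j, H j z) (Ah x) :=
      contDiffAt_const.add (ContDiffAt.sum fun j _ ↦ hHc j)
    exact this.congr_of_eventuallyEq (Filter.Eventually.of_forall hBb)
  have hBA : ContDiffAt ℝ ∞ (fun y ↦ Bb (Ah y)) x := hBbc.comp x hAc.contDiffAt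
  have hD : ContDiffAt ℝ ∞ (fderiv ℝ Ah) x := (hAc.fderiv_right (by simp)).contDiffAt
  have h1 := (contDiffWithinAt_bilinearComp_self (s := univ) hBA.contDiffWithinAt
    hD.contDiffWithinAt).contDiffAt univ_mem
  -- the model term is smooth at `x`
  have hradK : 0 < Kerr.radius 0 (poincareInv (Lorentz.boost V hV) 0 x) := by
    rw [poincareInv_zero, Kerr.radius_zero_left]
    exact hr
  have h2 : ContDiffAt ℝ ∞ (fun y ↦ boostedKerrBilin (Lorentz.boost V hV) 0 (M i) 0 y) x :=
    contDiffAt_boostedKerrBilin (Lorentz.boost V hV) 0 (M i) 0 hradK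
  exact h1.sub h2

/-! ### Registered form -/

/-- Registered sub-goal form (stub `spatialNorm_own_honest` of the crux item) of
`spatialNorm_own_honest'`. [folklore] -/
theorem spatialNorm_own_honest : open Literature.Geometry.Lorentzian in ∀ {N : ℕ} (i : Fin N) (ξ v : Fin N → ℝ → E3) (hv1 : ∀ j t, ‖v j t‖ < 1) {V : E3} (hV : ‖V‖ < 1) {Ah : E4 → E4}, (∀ y : E4, Ah y = E4.ofTimeSpace (y 0) (ξ i (y 0) + (ContinuousLinearMap.id ℝ E3 - (Lorentz.gamma (v i (y 0)) / (Lorentz.gamma (v i (y 0)) + 1)) • (innerSL ℝ (v i (y 0))).smulRight (v i (y 0))) (E4.spatial ((Lorentz.boost V hV : E4 ≃L[ℝ] E4).symm y)))) → ∀ x : E4, E4.spatialNorm (Lorentz.boostCLM (-v i (Ah x 0)) (Ah x - E4.ofTimeSpace (Ah x 0) (ξ i (Ah x 0)))) = ‖E4.spatial ((Lorentz.boost V hV : E4 ≃L[ℝ] E4).symm x)‖ :=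
  fun i ξ v hv1 _ hV _ hAh x ↦ spatialNorm_own_honest' i ξ v hv1 hV hAh x

end Estimate

end Summit.FinalStateConjecture.FinalStateConjecture.Theorems

end
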